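import Literature.NumberTheory.Automorphic.FontaineMazurGL2OddPrime
import Literature.NumberTheory.GaloisRepresentations.OrdinaryTwistedDeterminant
import Literature.NumberTheory.GaloisRepresentations.TateTwistFrobeniusProofs
import Literature.NumberTheory.GaloisRepresentations.TwistedSumFiniteOrderGeneric
import HarnessLib

/-!
# Fontaine–Mazur for `GL₂/ℚ` at EVERY prime for representations potentially crystalline and
# ordinary of Hodge–Tate weights `{0,1}` at `p` — no hypothesis on the residual image
# (Thorne 2026, Theorem D)

Topic `Literature/NumberTheory/Automorphic`; companion of `FontaineMazurGL2OddPrime` and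
`FontaineMazurGL2OddPrimeTateTwist` (same classical rendering of "modular": some Tate twist of
`ρ` is the Galois representation of a newform, `IsGaloisRepOfNewform1`).  One NAMED FACT
(D-0014), `Thorne2026_fontaineMazurGL2_potCrystallineOrdinary`, no discharge (irreducibly XL: a
depth-`C` modularity lifting theorem, geometry-of-numbers construction of ordinary HBAV
approximants, potential modularity, Serre's conjecture).

## The printed theorem (J. A. Thorne, *Towards the Fontaine–Mazur conjecture for `GL₂`*,
## arXiv:2608.07186, 7 Aug 2026 [Thorne2026FontaineMazurGL2]; held text, quoted)

* **Theorem D** (Introduction, p. 3): "Let `p` be a prime, and let `ρ : G_ℚ → GL₂(ℚ̄_p)` be a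
  continuous, irreducible representation satisfying the following conditions: (1) `ρ` is
  unramified at all but finitely many primes. (2) `ρ|_{G_{ℚ_p}}` is potentially crystalline and
  ordinary of Hodge–Tate weights `{0,1}`. (3) `det ρ` is odd. Then `ρ` is modular."  ("We deduce
  this from Theorem B, together with Serre's conjecture: the theorem implies that `ρ` lives in a
  weight 0, rank 2 compatible system, and the modularity of such compatible systems is a well-known
  consequence of Serre's conjecture [Kha10].")  The paper stresses (p. 3, before Theorem D) that it
  "applies in particular in the open case `p = 2`, `ρ̄` reducible": there is NO hypothesis on the
  prime `p` nor on the residual representation.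
* **Conjecture C / "modular"** (p. 2): "`ρ` is modular, in the sense that there is a cuspidal,
  regular algebraic automorphic representation `π` of `GL₂(𝔸_ℚ)` and an isomorphism
  `ι : ℚ̄_p → ℂ` such that `ρ ≅ r_{π,ι}`."
* **§1.1 Notation** (p. 4): "A representation `ρ : G_{F_v} → GL₂(ℚ̄_p)` is ordinary with
  Hodge–Tate weights `{0,1}` if there is an isomorphism `ρ ∼ ( ψ₁ ∗ ; 0 ε⁻¹ψ₂ )`, where
  `ψ₁, ψ₂ : G_{F_v} → ℚ̄_p^×` are finitely ramified characters (any such representation is de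
  Rham, with `HT_τ(ρ) = {0,1}` for any `τ`)" (`ε` the `p`-adic cyclotomic character,
  `HT_τ(ε) = {−1}`).

## Rendering in the tree's vocabulary (read before reviewing)

* `ρ` continuous, (1), irreducible, (3): `ρ : FramedGaloisRep ℚ (PadicAlgCl p) 2`,
  `∀ᶠ v in cofinite, ρ.IsUnramifiedAt v`, `ρ.toGaloisRep.IsIrreducible`, `ρ.IsOdd` — verbatim the
  clauses of `XZhang2024_fontaineMazurGL2_oddPrime`.
* (2), ordinary part: the accepted Skinner–Wiles predicate
  `FramedGaloisRep.IsOrdinaryOfWeightAt p ρ' v 2 m` (`OrdinaryGaloisRep`: after a change of frame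
  `ρ'|_{Γ_{ℚ_v}}` is upper triangular, and on the inertia subgroup the lower diagonal character
  `ψ₂` satisfies `ψ₂^m = 1` and the upper one equals `ε` up to an `m`-torsion character) says
  EXACTLY that `ρ' ≅ ( ψ₁ε ∗ ; 0 ψ₂ )` with `ψ₁, ψ₂` characters of `Γ_{ℚ_p}` whose restrictions to
  inertia are killed by `m`, i.e. finitely ramified; so `ρ' ⊗ ε⁻¹ ≅ ( ψ₁ ∗ ; 0 ε⁻¹ψ₂ )` is ordinary
  of Hodge–Tate weights `{0,1}` in Thorne's sense, and conversely every such representation has a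
  Tate twist of this shape (take `m` = the exponent of the finite group `ψ₁(I) ψ₂(I)`).
* (2), potentially crystalline part: for Fontaine's PINNED datum
  `𝔇 = PAdicHodge.fontainePstAdicCompletion v p hv` (`FontaineDpst`), "`ρ'|_{Γ_{ℚ_v}}` is
  potentially crystalline" is "`ρ'|_{Γ_{ℚ_v}}` is de Rham (`𝔇.IsDeRhamFramed`, so that a
  Weil–Deligne representation `WD(D_pst ρ')` EXISTS, `exists_of_isDeRham`, unique up to
  isomorphism) and every Weil–Deligne representation attached to it has `N = 0`":
  `𝔇.IsDeRhamFramed (ρ'.toLocal v) ∧ ∀ r, 𝔇.IsWeilDeligneOf (ρ'.toLocal v) r → r.N = 0` (the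
  monodromy of `D_pst` vanishes iff `D_pst = D_pcris`, Fontaine 1994, Exp. VIII §2.3.7).  The de
  Rham conjunct is what keeps the `N = 0` clause from being vacuous; it holds for Thorne's `ρ`
  (ordinary with finitely ramified characters ⇒ potentially semistable ⇒ de Rham).  Potential crystallinity and the a.e.-unramified / irreducible / odd clauses are
  invariant under Tate twists, which is why they may be imposed on `ρ` or on `ρ'` indifferently.
* THE TATE TWIST IS FOLDED IN (as in the accepted `Pan2022_proModularDeRhamClassical_GL2Q`, whose
  hypothesis has arbitrary distinct Hodge–Tate weights where Pan prints `{0,k}`): the hypothesis is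
  that SOME Tate twist `ρ' = ρ ⊗ ε^a` (`χ₀ σ = cyclotomicPadicAlgCl ℚ p σ ^ a`, accepted
  `FramedRep.twist`) is potentially crystalline and Skinner–Wiles-ordinary of weight `2` at the
  place above `p`.  Theorem D applied to `ρ' ⊗ ε⁻¹` (continuous, irreducible, a.e. unramified and
  odd together with `ρ`: `ε` is unramified away from `p` and `ε(c)² = 1`) gives that `ρ' ⊗ ε⁻¹`,
  hence a Tate twist of `ρ`, is modular.
* "modular" (`ρ ≅ r_{π,ι}`, `π` cuspidal regular algebraic on `GL₂(𝔸_ℚ)`): the CLASSICAL rendering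
  shared with `XZhang2024_fontaineMazurGL2_tateTwist` — over `ℚ` such a `π` is `π_f ⊗ |det|^s` for a
  newform `f` of weight `k ≥ 2`, and `r_ι(π_f ⊗ |det|^s)` is a Tate twist of Deligne's `ρ_{f,ι_f}`
  (Deligne–Serre 1974, Thm. 6.1 normalisation, arithmetic Frobenius:
  `charpoly ρ_{f,ι_f}(Frob_q) = ι_f(X² − a_q X + ε_f(q) q^{k−1})`, `q ∤ N p`); so the conclusion is:
  for some `χ = ε^m`, some newform `f ∈ S_k(Γ₁(N))` and some `ι_f : K_f → ℚ̄_p`,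
  `IsGaloisRepOfNewform1 f ι_f {q ∣ N p} (ρ ⊗ χ)` — VERBATIM the conclusion of
  `XZhang2024_fontaineMazurGL2_tateTwist` (only the a.e. unramified dictionary is rendered; the
  local–global compatibility at ramified places and at `p` contained in `ρ ≅ r_{π,ι}` is dropped,
  which weakens the fact).

## What is NOT here (and why)

* Theorem B (potential modularity over a totally real `F`) and Theorem 4.1 (the depth-`C`
  modularity lifting theorem): no carrier in the tree for "`ρ mod ϖ^C ≅ ρ' mod ϖ^C`"-modularity
  or for the constants `C(ρ)`; they are not needed by the consumers.
* No discharge (irreducibly XL).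
* Consumers: the dyadic cruxes of routes `Langlands/DyadicOddResidue` and
  `Langlands/OddResidueBelowFive` (`DyadicDihedralFM`, `DyadicEisensteinFM`, `TwoAdicDihedral`,
  `TwoAdicEisenstein`): at `p = 2` this is the only printed modularity theorem with no hypothesis on
  `ρ̄`; it closes their potentially-crystalline-ordinary consecutive-weight cells.

## References

* J. A. Thorne, *Towards the Fontaine–Mazur conjecture for `GL₂`*, arXiv:2608.07186 (2026),
  Theorem D, Theorem B, Conjecture C, §1.1. [Thorne2026FontaineMazurGL2]
* C. Khare, *Serre's conjecture and its consequences*, Jpn. J. Math. 5 (2010) (the deduction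
  "weight 0 rank 2 compatible system ⇒ modular" quoted by Thorne as [Kha10]).
* L. Dieulefait, *Existence of families of Galois representations and new cases of the
  Fontaine–Mazur conjecture*, J. reine angew. Math. 577 (2004), Thm. 1.1 (quoted as [Die04]).
* P. Deligne, J.-P. Serre, Ann. Sci. ÉNS 7 (1974), Thm. 6.1 (normalisation of `ρ_{f,λ}`).
  [DeligneSerreASENS1974]
* C. Skinner, A. Wiles, Publ. Math. IHÉS 89 (1999), §1 (the ordinary shape
  `( ψ₁χ^{k−1} ∗ ; 0 ψ₂ )`, here `k = 2`). [SkinnerWiles1999]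
-/

noncomputable section

open scoped MatrixGroups Matrix NumberField ModularForm
open NumberField IsDedekindDomain Field Filter CongruenceSubgroup

namespace Literature.NumberTheory.Automorphic

open Literature.NumberTheory.GaloisRepresentations
open Literature.NumberTheory.EllipticCurves.ModularForms

/-- **Thorne 2026, Theorem D: Fontaine–Mazur modularity for `GL₂` over `ℚ` at EVERY prime `p`
(including `p = 2`) and for EVERY residual image, for representations potentially crystalline and
ordinary of Hodge–Tate weights `{0,1}` at `p` — rendering with a Tate twist** (module docstring for
the printed statement and the rendering).  Let `p` be any prime and `ρ : Γ_ℚ → GL₂(ℚ̄_p)`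
continuous, unramified at all but finitely many places, irreducible and odd.  Suppose some Tate
twist `ρ' = ρ ⊗ ε_p^a` is, at the place `v` above `p`, Skinner–Wiles-ordinary of weight `2`
(`IsOrdinaryOfWeightAt p ρ' v 2 m`: `ρ'|_{Γ_{ℚ_p}} ≅ ( ψ₁ε ∗ ; 0 ψ₂ )` with `ψ₁, ψ₂` finitely
ramified — i.e. `ρ' ⊗ ε⁻¹` is "ordinary of Hodge–Tate weights `{0,1}`" in Thorne's sense) and
potentially crystalline (the Weil–Deligne representation attached to `ρ'|_{Γ_{ℚ_p}}` by Fontaine's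
pinned `D_pst` datum has `N = 0`).  Then `ρ` is modular up to a Tate twist: there are a continuous
character `χ : Γ_ℚ → ℚ̄_pˣ` with `χ(σ) = ε_p(σ)^m` for an integer `m`, a newform `f ∈ S_k(Γ₁(N))`
and an embedding `ι_f : K_f → ℚ̄_p` of its coefficient field such that `ρ ⊗ χ` is attached to `f`
away from `N p` — unramified at every prime `q ∤ N p` with
`charpoly (ρ ⊗ χ)(Frob_q) = ι_f(X² − a_q(f) X + ε_f(q) q^{k−1})` (arithmetic Frobenius).  Named
fact (D-0014); users take `(h : Thorne2026_fontaineMazurGL2_potCrystallineOrdinary)`.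
[cite: Thorne2026FontaineMazurGL2, Theorem D (Introduction, p. 3 of arXiv:2608.07186), with §1.1 ("ordinary with Hodge–Tate weights {0,1}") and p. 2 (meaning of "modular")]
[cite: DeligneSerreASENS1974, Thm. 6.1] [cite: SkinnerWiles1999, §1] -/
def Thorne2026_fontaineMazurGL2_potCrystallineOrdinary : Prop :=
  ∀ (p : ℕ) [Fact p.Prime] (ρ : FramedGaloisRep ℚ (PadicAlgCl p) 2),
    (∀ᶠ v : HeightOneSpectrum (𝓞 ℚ) in cofinite, ρ.IsUnramifiedAt v) →
    ρ.toGaloisRep.IsIrreducible → ρ.IsOdd →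
    (∃ (χ₀ : absoluteGaloisGroup ℚ →ₜ* (PadicAlgCl p)ˣ) (a : ℤ) (m : ℕ),
      (∀ σ, χ₀ σ = cyclotomicPadicAlgCl ℚ p σ ^ a) ∧ 0 < m ∧
      ∀ (v : HeightOneSpectrum (𝓞 ℚ)) (hv : ((p : ℕ) : 𝓞 ℚ) ∈ v.asIdeal),
        FramedGaloisRep.IsOrdinaryOfWeightAt p (FramedRep.twist ρ χ₀) v 2 m ∧
        (PAdicHodge.fontainePstAdicCompletion v p hv).IsDeRhamFramed
          (FramedGaloisRep.toLocal v (FramedRep.twist ρ χ₀)) ∧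
        ∀ r, (PAdicHodge.fontainePstAdicCompletion v p hv).IsWeilDeligneOf
          (FramedGaloisRep.toLocal v (FramedRep.twist ρ χ₀)) r → r.N = 0) →
    ∃ (χ : absoluteGaloisGroup ℚ →ₜ* (PadicAlgCl p)ˣ) (m : ℤ),
      (∀ σ, χ σ = cyclotomicPadicAlgCl ℚ p σ ^ m) ∧
      ∃ (N : ℕ) (_ : NeZero N) (k : ℤ) (f : CuspForm (Gamma1 N) k)
        (ιf : coeffCharField f →+* PadicAlgCl p),
        IsNewform1 f ∧ IsGaloisRepOfNewform1 f ιf {q | q ∣ N * p} (FramedRep.twist ρ χ)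

/-- **The untwisted case of Thorne's Theorem D** — the shape its consumers have (`a = 0`,
`χ₀ = 1`): let `p` be any prime and `ρ : Γ_ℚ → GL₂(ℚ̄_p)` continuous, unramified at all but
finitely many places, irreducible and odd, such that at the place `v` above `p` the representation
`ρ` ITSELF is Skinner–Wiles-ordinary of weight `2` with some inertial exponent `m ≥ 1`
(`IsOrdinaryOfWeightAt p ρ v 2 m`, i.e. `ρ ⊗ ε⁻¹` is ordinary of Hodge–Tate weights `{0,1}` in
Thorne's sense), de Rham for Fontaine's pinned datum and potentially crystalline (`N = 0` on every
Weil–Deligne representation the datum attaches to `ρ|_{Γ_{ℚ_p}}`).  Then `ρ` is modular up to a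
Tate twist, in the classical newform sense of the named fact.  Proved from
`(h : Thorne2026_fontaineMazurGL2_potCrystallineOrdinary)` by instantiating the twist with the
trivial character (`FramedRep.twist_one`).
[cite: Thorne2026FontaineMazurGL2, Theorem D (Introduction, p. 3 of arXiv:2608.07186)] -/
theorem Thorne2026_fontaineMazurGL2_potCrystallineOrdinary.of_untwisted
    (h : Thorne2026_fontaineMazurGL2_potCrystallineOrdinary) {p : ℕ} [Fact p.Prime]
    (ρ : FramedGaloisRep ℚ (PadicAlgCl p) 2)
    (hunr : ∀ᶠ v : HeightOneSpectrum (𝓞 ℚ) in cofinite, ρ.IsUnramifiedAt v)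
    (hirr : ρ.toGaloisRep.IsIrreducible) (hodd : ρ.IsOdd) {m : ℕ} (hm : 0 < m)
    (hp : ∀ (v : HeightOneSpectrum (𝓞 ℚ)) (hv : ((p : ℕ) : 𝓞 ℚ) ∈ v.asIdeal),
        FramedGaloisRep.IsOrdinaryOfWeightAt p ρ v 2 m ∧
        (PAdicHodge.fontainePstAdicCompletion v p hv).IsDeRhamFramed
          (FramedGaloisRep.toLocal v ρ) ∧
        ∀ r, (PAdicHodge.fontainePstAdicCompletion v p hv).IsWeilDeligneOf
          (FramedGaloisRep.toLocal v ρ) r → r.N = 0) :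
    ∃ (χ : absoluteGaloisGroup ℚ →ₜ* (PadicAlgCl p)ˣ) (m : ℤ),
      (∀ σ, χ σ = cyclotomicPadicAlgCl ℚ p σ ^ m) ∧
      ∃ (N : ℕ) (_ : NeZero N) (k : ℤ) (f : CuspForm (Gamma1 N) k)
        (ιf : coeffCharField f →+* PadicAlgCl p),
        IsNewform1 f ∧ IsGaloisRepOfNewform1 f ιf {q | q ∣ N * p} (FramedRep.twist ρ χ) := by
  refine h p ρ hunr hirr hodd ⟨1, 0, m, fun σ => ?_, hm, fun v hv => ?_⟩
  · rw [ContinuousMonoidHom.coe_one, Pi.one_apply, zpow_zero]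
  · rw [FramedRep.twist_one]
    exact hp v hv

/-- **A Tate twist `ε_p^a` of `Γ_ℚ` is trivial on the inertia groups away from `p`** (the
`p`-adic cyclotomic character is unramified at `v ∤ p`,
`FramedGaloisRep.isUnramifiedAt_cyclotomic_holds`). [folklore] -/
theorem eq_one_of_mem_inertia_of_eq_cyclotomicPadicAlgCl_zpow {p : ℕ} [Fact p.Prime]
    {χ₀ : absoluteGaloisGroup ℚ →ₜ* (PadicAlgCl p)ˣ} {a : ℤ}
    (hχ₀ : ∀ σ, χ₀ σ = cyclotomicPadicAlgCl ℚ p σ ^ a)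
    {v : HeightOneSpectrum (𝓞 ℚ)} (hv : ((p : ℕ) : 𝓞 ℚ) ∉ v.asIdeal)
    {𝔓 : Ideal (absIntegers (𝓞 ℚ) ℚ)} (h𝔓 : 𝔓 ∈ v.primesAbove)
    {σ : absoluteGaloisGroup ℚ} (hσ : σ ∈ 𝔓.inertia (absoluteGaloisGroup ℚ)) :
    χ₀ σ = 1 := by
  have h1 : GaloisRep.cyclotomicCharacter ℚ p σ = 1 := by
    have h := FramedGaloisRep.det_cyclotomic_apply ℚ p σ
    rw [FramedRep.det_apply, FramedGaloisRep.isUnramifiedAt_cyclotomic_holds ℚ p hv 𝔓 h𝔓 σ hσ,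
      map_one] at h
    exact h.symm
  have h2 : cyclotomicPadicAlgCl ℚ p σ = 1 := by
    apply Units.ext
    rw [coe_cyclotomicPadicAlgCl_apply, h1, Units.val_one, Units.val_one, PadicInt.coe_one, map_one]
  rw [hχ₀ σ, h2, one_zpow]

/-- **The Tate twist folded into `Thorne2026_fontaineMazurGL2_potCrystallineOrdinary` adds no
strength: the named fact is EQUIVALENT to its untwisted (`a = 0`, `χ₀ = 1`) specialisation**, i.e.
to the statement "every continuous, a.e. unramified, irreducible, odd `ρ : Γ_ℚ → GL₂(ℚ̄_p)` that is
ITSELF Skinner–Wiles-ordinary of weight `2` (some inertial exponent `m ≥ 1`), de Rham for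
Fontaine's pinned datum and potentially crystalline at the place above `p` is modular up to a
Tate twist" (the shape of `Thorne2026_fontaineMazurGL2_potCrystallineOrdinary.of_untwisted`).
The forward direction is `of_untwisted`; conversely, given `ρ` and a Tate twist `ρ' = ρ ⊗ ε_p^a`
satisfying the local hypotheses, `ρ'` is again a.e. unramified (`ε_p^a` is trivial on inertia at
`v ∤ p`, `eq_one_of_mem_inertia_of_eq_cyclotomicPadicAlgCl_zpow`, and the places above `p` are
finitely many), irreducible (`Representation.isIrreducible_twist_iff`) and odd
(`det (ρ ⊗ χ₀)(c) = χ₀(c)² det ρ(c)` and `c² = 1`), so the untwisted statement makes `ρ' ⊗ ε_p^m`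
modular, and `ρ' ⊗ ε_p^m = ρ ⊗ ε_p^{m+a}` (`FramedRep.twist_twist`).  This is the kernel-checked
form of the Tate-twist bookkeeping in the module docstring ("THE TATE TWIST IS FOLDED IN"): a
discharge of the named fact need only treat `a = 0`.
[cite: Thorne2026FontaineMazurGL2, Theorem D (Introduction, p. 3 of arXiv:2608.07186)] -/
theorem Thorne2026_fontaineMazurGL2_potCrystallineOrdinary_iff_untwisted :
    Thorne2026_fontaineMazurGL2_potCrystallineOrdinary ↔
      ∀ (p : ℕ) [Fact p.Prime] (ρ : FramedGaloisRep ℚ (PadicAlgCl p) 2),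
        (∀ᶠ v : HeightOneSpectrum (𝓞 ℚ) in cofinite, ρ.IsUnramifiedAt v) →
        ρ.toGaloisRep.IsIrreducible → ρ.IsOdd → ∀ (m : ℕ), 0 < m →
        (∀ (v : HeightOneSpectrum (𝓞 ℚ)) (hv : ((p : ℕ) : 𝓞 ℚ) ∈ v.asIdeal),
            FramedGaloisRep.IsOrdinaryOfWeightAt p ρ v 2 m ∧
            (PAdicHodge.fontainePstAdicCompletion v p hv).IsDeRhamFramed
              (FramedGaloisRep.toLocal v ρ) ∧
            ∀ r, (PAdicHodge.fontainePstAdicCompletion v p hv).IsWeilDeligneOf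
              (FramedGaloisRep.toLocal v ρ) r → r.N = 0) →
        ∃ (χ : absoluteGaloisGroup ℚ →ₜ* (PadicAlgCl p)ˣ) (m : ℤ),
          (∀ σ, χ σ = cyclotomicPadicAlgCl ℚ p σ ^ m) ∧
          ∃ (N : ℕ) (_ : NeZero N) (k : ℤ) (f : CuspForm (Gamma1 N) k)
            (ιf : coeffCharField f →+* PadicAlgCl p),
            IsNewform1 f ∧ IsGaloisRepOfNewform1 f ιf {q | q ∣ N * p} (FramedRep.twist ρ χ) := by
  refine ⟨fun h p _ ρ hunr hirr hodd m hm hp => h.of_untwisted ρ hunr hirr hodd hm hp,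
    fun H p _ ρ hunr hirr hodd ⟨χ₀, a, m, hχ₀, hm, hp⟩ => ?_⟩
  -- the finitely many places above `p`
  have hfin : {v : HeightOneSpectrum (𝓞 ℚ) | ((p : ℕ) : 𝓞 ℚ) ∈ v.asIdeal}.Finite := by
    have hp0 : (Ideal.span {((p : ℕ) : 𝓞 ℚ)} : Ideal (𝓞 ℚ)) ≠ ⊥ := by
      rw [Ne, Ideal.span_singleton_eq_bot]
      exact_mod_cast (Fact.out : p.Prime).ne_zero
    exact (Ideal.finite_factors hp0).subset fun v hv => Ideal.dvd_span_singleton.2 hv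
  -- `ρ ⊗ ε_p^a` is a.e. unramified, irreducible and odd together with `ρ`
  have hunr₁ : ∀ᶠ v : HeightOneSpectrum (𝓞 ℚ) in cofinite,
      FramedGaloisRep.IsUnramifiedAt v (FramedRep.twist ρ χ₀) := by
    filter_upwards [hunr, hfin.compl_mem_cofinite] with v hv hpv
    exact FramedGaloisRep.isUnramifiedAt_twist hv fun 𝔓 h𝔓 σ hσ =>
      eq_one_of_mem_inertia_of_eq_cyclotomicPadicAlgCl_zpow hχ₀ hpv h𝔓 hσ
  have hirr₁ : (FramedGaloisRep.toGaloisRep (FramedRep.twist ρ χ₀)).IsIrreducible := by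
    change (FramedRep.twist ρ χ₀).toRepresentation.IsIrreducible
    rw [FramedRep.toRepresentation_twist]
    exact (Literature.RepresentationTheory.Semisimple.Representation.isIrreducible_twist_iff _ _).2
      hirr
  have hodd₁ : FramedGaloisRep.IsOdd (FramedRep.twist ρ χ₀) := by
    intro φ c hc
    have h2 : χ₀ c ^ 2 = 1 := by rw [← map_pow, hc.sq_eq_one, map_one]
    rw [FramedRep.det_twist_apply, hodd φ c hc, h2, one_mul]
  obtain ⟨χ, m', hχ, N, hN, k, f, ιf, hnew, hgal⟩ :=
    H p (FramedRep.twist ρ χ₀) hunr₁ hirr₁ hodd₁ m hm hp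
  refine ⟨χ * χ₀, m' + a, fun σ => ?_, N, hN, k, f, ιf, hnew, ?_⟩
  · rw [ContinuousMonoidHom.mul_apply, hχ σ, hχ₀ σ, zpow_add]
  · rwa [FramedRep.twist_twist] at hgal

end Literature.NumberTheory.Automorphic

end
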